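import Mathlib.Analysis.Complex.Basic
import Mathlib.Analysis.InnerProductSpace.PiL2
import Mathlib.Analysis.SpecialFunctions.Sqrt
import HarnessLib

/-!
# Honda's untwisted local model `ω_A` of a near-symplectic form, and its toroidal avatar in `ℝ⁴`

Topic `Literature/Geometry/Symplectic` (groundwork for the named fact
`Literature.Geometry.Symplectic.relNearSymplecticTaubesTubes_exists`,
`NearSymplecticPuncturedSphere.lean`, docstring steps 3–5; everything here is PROVED, no named
facts).

## Content

* `hondaFormA` — Honda's `S¹`-invariant model **(A)** of a self-dual harmonic / near-symplectic
  form along an *untwisted* (even) zero circle, on `ℝ_θ × ℝ³` with coordinates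
  `q = (θ, x₁, x₂, x₃) = (q 0, q 1, q 2, q 3)`:
  `ω_A = dθ ∧ dQ + ⋆₃ dQ = x₁(dθ∧dx₁ + dx₂∧dx₃) + x₂(dθ∧dx₂ + dx₃∧dx₁) − 2x₃(dθ∧dx₃ + dx₁∧dx₂)`,
  `Q = ½(x₁² + x₂²) − x₃²` (Honda 2004, §4 Thm. 4 (A); = Taubes 1998, eq. (1.1); Perutz 2006, §2,
  `Θ = x₁β₁ + x₂β₂ − 2x₃β₃`; Gerig 2021, §3), written as a real function of the point `q` and two
  flat vectors `U, V`.  Proved: antisymmetry, `θ`-independence (`S¹`-invariance), vanishing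
  exactly on the axis `{x = 0}` and the explicit non-degeneracy identity
  `ω_A(U, J_q U) = (x₁² + x₂² + 4x₃²)|U|²` off the axis (`ω_A ∧ ω_A = 2|dQ|² dθ∧dx₁₂₃`).
* `untwistedTubeForm` — the same model in the flat toroidal coordinates of `ℝ⁴` about the unit
  circle `C₀ = {y₀² + y₁² = 1, y₂ = y₃ = 0}`: `t = arg(y₀ + iy₁)`, `a = √(y₀² + y₁²) − 1`,
  `b = y₂`, `c = y₃`, i.e. LITERALLY the `let`-bound `formT` of the named fact (coframe
  `toroidalDt = (y₀dy₁ − y₁dy₀)/r²`, `toroidalDa = dr`), with the flat solid torus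
  `flatSolidTorus δ` (the fact's `U`) and core circle `flatCoreCircle` (the fact's `C`); the
  model tube `hondaTube r = ℝ × B³(r)` and axis `hondaAxis = ℝ × {0}` upstairs; and the complex
  coordinate `toroidalZ y = y₀ + iy₁` (`|z| = toroidalR y`).
* `hondaFormA_eq_untwistedTubeForm` — the substitution identity: `ω_A` at
  `x = (a, b, c)` on vectors with components `(dt u, da u, u₂, u₃)` IS `formT y u v` (the
  algebraic half of "`T*ω_A = formT`", `T` the toroidal coordinate map of
  `ToroidalCoordinates`-type files downstream).

## Not here

The toroidal coordinate map itself (`arg`, its derivative, the branch across the cut) and the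
reduction of the named fact to model charts live in the sibling files importing this one.  No
differential-form packaging (`extDeriv`) is attempted here: the statements downstream evaluate
forms on pairs of vectors, exactly as the named fact does.

## References

* K. Honda, *Local properties of self-dual harmonic 2-forms on a 4-manifold*, J. reine angew. Math.
  577 (2004), §4 Thm. 4 (A) [Honda2004LocalSD].
* C. H. Taubes, *The structure of pseudo-holomorphic subvarieties for a degenerate almost complex
  structure and symplectic form on `S¹ × B³`*, Geom. Topol. 2 (1998), eq. (1.1) [Taubes1998S1B3].
* T. Perutz, *Zero-sets of near-symplectic forms*, J. Symplectic Geom. 4 (2006), §2 [Perutz2006].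
-/

noncomputable section

open Set

namespace Literature.Geometry.Symplectic

/-- Local notation for the model space `ℝ⁴ = EuclideanSpace ℝ (Fin 4)`. -/
local notation "E4" => EuclideanSpace ℝ (Fin 4)

/-! ### Honda's model (A) on `ℝ_θ × ℝ³` -/

/-- `dQ_q(U) = x₁U₁ + x₂U₂ − 2x₃U₃`, the differential of `Q = ½(x₁² + x₂²) − x₃²` at
`q = (θ, x₁, x₂, x₃)` on the flat vector `U` (Honda 2004, §4: `μ = d(½(x₁² + x₂²) − x₃²)`).
[cite: Honda2004LocalSD, §4 Thm. 4 (A)] -/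
def hondaDQ (q U : E4) : ℝ :=
  q 1 * U 1 + q 2 * U 2 - 2 * q 3 * U 3

/-- **Honda's untwisted model `ω_A = dθ ∧ dQ + ⋆₃ dQ`** on `ℝ_θ × ℝ³`, evaluated at the point
`q = (θ, x₁, x₂, x₃)` on the flat vectors `U, V`:
`(dθ∧dQ)(U,V) + x₁ (dx₂∧dx₃)(U,V) + x₂ (dx₃∧dx₁)(U,V) − 2x₃ (dx₁∧dx₂)(U,V)`
(Honda 2004, §4 Thm. 4 (A): `ω_A = x₁(dθdx₁ + dx₂dx₃) + x₂(dθdx₂ + dx₃dx₁) − 2x₃(dθdx₃ + dx₁dx₂)`;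
Taubes 1998, eq. (1.1)). [cite: Honda2004LocalSD, §4 Thm. 4 (A)] -/
def hondaFormA (q U V : E4) : ℝ :=
  U 0 * hondaDQ q V - V 0 * hondaDQ q U
    + q 1 * (U 2 * V 3 - V 2 * U 3)
    + q 2 * (U 3 * V 1 - V 3 * U 1)
    - 2 * q 3 * (U 1 * V 2 - V 1 * U 2)

/-- The model tube `ℝ × B³(r) = {x₁² + x₂² + x₃² < r²}` about the axis (Honda 2004, §4:
`N(C) = S¹ × D³` upstairs). [cite: Honda2004LocalSD, §4 Thm. 4 (A)] -/
def hondaTube (r : ℝ) : Set E4 :=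
  {q | q 1 ^ 2 + q 2 ^ 2 + q 3 ^ 2 < r ^ 2}

/-- The axis `ℝ × {0} = {x₁ = x₂ = x₃ = 0}`, the zero set of `ω_A` (the zero circle upstairs).
[cite: Honda2004LocalSD, §4 Thm. 4 (A)] -/
def hondaAxis : Set E4 :=
  {q | q 1 = 0 ∧ q 2 = 0 ∧ q 3 = 0}

/-- Membership in the model tube, unfolded. [folklore] -/
theorem mem_hondaTube {r : ℝ} {q : E4} : q ∈ hondaTube r ↔ q 1 ^ 2 + q 2 ^ 2 + q 3 ^ 2 < r ^ 2 :=
  Iff.rfl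

/-- Membership in the axis, unfolded. [folklore] -/
theorem mem_hondaAxis {q : E4} : q ∈ hondaAxis ↔ q 1 = 0 ∧ q 2 = 0 ∧ q 3 = 0 := Iff.rfl

/-- The axis lies in every model tube of positive radius. [folklore] -/
theorem hondaAxis_subset_hondaTube {r : ℝ} (hr : 0 < r) : hondaAxis ⊆ hondaTube r := by
  intro q hq
  rcases hq with ⟨h1, h2, h3⟩
  simpa [mem_hondaTube, h1, h2, h3] using pow_pos hr 2

/-- Membership in the model tube only involves the normal coordinates `x = (q 1, q 2, q 3)`.
[folklore] -/
theorem mem_hondaTube_of_eq {r : ℝ} {q q' : E4} (hq : q ∈ hondaTube r) (h1 : q' 1 = q 1)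
    (h2 : q' 2 = q 2) (h3 : q' 3 = q 3) : q' ∈ hondaTube r := by
  rw [mem_hondaTube] at hq ⊢; rw [h1, h2, h3]; exact hq

/-- Shifting along the angular axis `e_θ = e₀` preserves the model tube. [folklore] -/
theorem add_smul_single_mem_hondaTube {r : ℝ} {q : E4} (hq : q ∈ hondaTube r) (c : ℝ) :
    q + c • EuclideanSpace.single (0 : Fin 4) (1 : ℝ) ∈ hondaTube r :=
  mem_hondaTube_of_eq hq (by simp) (by simp) (by simp)

/-- Shifting along the angular axis preserves (non-)membership in the axis. [folklore] -/
theorem mem_hondaAxis_add_smul_single_iff {q : E4} {c : ℝ} :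
    q + c • EuclideanSpace.single (0 : Fin 4) (1 : ℝ) ∈ hondaAxis ↔ q ∈ hondaAxis := by
  simp [mem_hondaAxis]

/-- `ω_A` is antisymmetric. [folklore] -/
theorem hondaFormA_swap (q U V : E4) : hondaFormA q V U = -hondaFormA q U V := by
  simp only [hondaFormA, hondaDQ]; ring

/-- `ω_A(U, U) = 0`. [folklore] -/
@[simp] theorem hondaFormA_self (q U : E4) : hondaFormA q U U = 0 := by
  simp only [hondaFormA, hondaDQ]; ring

/-- `ω_A` is additive in its first vector argument. [folklore] -/
theorem hondaFormA_add_left (q U U' V : E4) :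
    hondaFormA q (U + U') V = hondaFormA q U V + hondaFormA q U' V := by
  simp only [hondaFormA, hondaDQ, PiLp.add_apply]; ring

/-- `ω_A` is homogeneous in its first vector argument. [folklore] -/
theorem hondaFormA_smul_left (q U V : E4) (c : ℝ) :
    hondaFormA q (c • U) V = c * hondaFormA q U V := by
  simp only [hondaFormA, hondaDQ, PiLp.smul_apply, smul_eq_mul]; ring

/-- **`S¹`-invariance**: `ω_A` does not depend on the angular coordinate `θ = q 0` (its
coefficients are functions of `x = (q 1, q 2, q 3)` only). [cite: Honda2004LocalSD, §4 Thm. 4 (A)] -/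
theorem hondaFormA_congr {q q' : E4} (h1 : q 1 = q' 1) (h2 : q 2 = q' 2) (h3 : q 3 = q' 3) :
    hondaFormA q = hondaFormA q' := by
  funext U V
  simp only [hondaFormA, hondaDQ, h1, h2, h3]

/-- `ω_A` vanishes on the axis `{x = 0}`. [cite: Honda2004LocalSD, §4 Thm. 4 (A)] -/
theorem hondaFormA_eq_zero_of_mem_hondaAxis {q : E4} (hq : q ∈ hondaAxis) (U V : E4) :
    hondaFormA q U V = 0 := by
  rcases hq with ⟨h1, h2, h3⟩
  simp only [hondaFormA, hondaDQ, h1, h2, h3]; ring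

/-- The vector `J_q U := Ω_qᵀ U` paired against `U` in the non-degeneracy identity
`ω_A(U, J_q U) = (x₁² + x₂² + 4x₃²)|U|²` (`Ω_q` the matrix of `ω_A` at `q`, a scaled quaternion:
`Ω_q² = −(x₁² + x₂² + 4x₃²)·1`). [folklore] -/
def hondaDualVec (q U : E4) : E4 :=
  WithLp.toLp 2
    ![-hondaDQ q U,
      q 1 * U 0 + 2 * q 3 * U 2 + q 2 * U 3,
      q 2 * U 0 - 2 * q 3 * U 1 - q 1 * U 3,
      -(2 * q 3 * U 0) - q 2 * U 1 + q 1 * U 2]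

/-- **Non-degeneracy identity** `ω_A(U, J_q U) = (x₁² + x₂² + 4x₃²)(U₀² + U₁² + U₂² + U₃²)`
(the pointwise content of `ω_A ∧ ω_A = 2|dQ|² dθ ∧ dx₁ ∧ dx₂ ∧ dx₃ > 0` off the axis; Honda 2004,
§4, Perutz 2006, §2). [folklore] -/
theorem hondaFormA_hondaDualVec (q U : E4) :
    hondaFormA q U (hondaDualVec q U) =
      (q 1 ^ 2 + q 2 ^ 2 + 4 * q 3 ^ 2) * (U 0 ^ 2 + U 1 ^ 2 + U 2 ^ 2 + U 3 ^ 2) := by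
  simp only [hondaFormA, hondaDualVec, hondaDQ, PiLp.toLp_apply, Matrix.cons_val_zero,
    Matrix.cons_val_one, Matrix.cons_val]
  ring

/-- The sum of squares of the components of a vector of `ℝ⁴` is `‖U‖²`. [folklore] -/
theorem sum_sq_four_eq_norm_sq (U : E4) : U 0 ^ 2 + U 1 ^ 2 + U 2 ^ 2 + U 3 ^ 2 = ‖U‖ ^ 2 := by
  rw [EuclideanSpace.real_norm_sq_eq, Fin.sum_univ_four]

/-- **`ω_A` is non-degenerate off the axis**: for `x ≠ 0` and `U ≠ 0` there is `V` with
`ω_A(U, V) ≠ 0` (Honda 2004, §4: `ω_A` is symplectic off its zero circle; Perutz 2006, §2).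
[cite: Honda2004LocalSD, §4 Thm. 4 (A)] -/
theorem hondaFormA_nondegenerate {q : E4} (hq : q ∉ hondaAxis) {U : E4} (hU : U ≠ 0) :
    ∃ V : E4, hondaFormA q U V ≠ 0 := by
  refine ⟨hondaDualVec q U, ?_⟩
  rw [hondaFormA_hondaDualVec, sum_sq_four_eq_norm_sq]
  have h1 : 0 < q 1 ^ 2 + q 2 ^ 2 + 4 * q 3 ^ 2 := by
    by_contra h
    apply hq
    have h0 : q 1 ^ 2 + q 2 ^ 2 + 4 * q 3 ^ 2 = 0 := le_antisymm (not_lt.1 h) (by positivity)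
    refine ⟨?_, ?_, ?_⟩ <;> nlinarith [sq_nonneg (q 1), sq_nonneg (q 2), sq_nonneg (q 3)]
  have h2 : 0 < ‖U‖ ^ 2 := by positivity
  positivity

/-- **The zero set of `ω_A` is exactly the axis.** [cite: Honda2004LocalSD, §4 Thm. 4 (A)] -/
theorem forall_hondaFormA_eq_zero_iff (q : E4) :
    (∀ U V : E4, hondaFormA q U V = 0) ↔ q ∈ hondaAxis := by
  refine ⟨fun h => ?_, fun h U V => hondaFormA_eq_zero_of_mem_hondaAxis h U V⟩
  by_contra hq
  have hU : (EuclideanSpace.single 0 1 : E4) ≠ 0 := by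
    intro h0
    have := congrArg (fun w : E4 => w 0) h0
    simp at this
  obtain ⟨V, hV⟩ := hondaFormA_nondegenerate hq hU
  exact hV (h _ V)

/-! ### The toroidal avatar in `ℝ⁴` (the `let`s of the named fact) -/

/-- `toroidalR y = √(y₀² + y₁²)`, the distance from the axis `{y₀ = y₁ = 0}` of `ℝ⁴`
(junk-free; `a = toroidalR y − 1` is the first normal toroidal coordinate about the unit circle).
[cite: Taubes1998S1B3, §1.c] -/
def toroidalR (y : E4) : ℝ :=
  Real.sqrt (y 0 ^ 2 + y 1 ^ 2)

/-- `toroidalDt y u = dt(u) = (y₀u₁ − y₁u₀)/r²`, the differential of the angle `t = arg(y₀ + iy₁)`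
on the flat vector `u` at `y` (junk value `0` on the axis `r = 0`). [cite: Taubes1998S1B3, §1.c] -/
def toroidalDt (y u : E4) : ℝ :=
  (y 0 * u 1 - y 1 * u 0) / toroidalR y ^ 2

/-- `toroidalDa y u = da(u) = dr(u) = (y₀u₀ + y₁u₁)/r` (junk value `0` on the axis).
[cite: Taubes1998S1B3, §1.c] -/
def toroidalDa (y u : E4) : ℝ :=
  (y 0 * u 0 + y 1 * u 1) / toroidalR y

/-- `untwistedDQ y u = dQ(u) = a da(u) + b u₂ − 2c u₃`, `a = r − 1`, `b = y₂`, `c = y₃`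
(`Q = ½(a² + b²) − c²`). [cite: Taubes1998S1B3, eq. (1.1)] -/
def untwistedDQ (y u : E4) : ℝ :=
  (toroidalR y - 1) * toroidalDa y u + y 2 * u 2 - 2 * y 3 * u 3

/-- **Taubes' untwisted model in flat toroidal coordinates**
`formT = dt ∧ dQ + a db∧dc + b dc∧da − 2c da∧db` on the flat vectors `u, v` at `y ∈ ℝ⁴`
(`t = arg(y₀ + iy₁)`, `a = √(y₀² + y₁²) − 1`, `b = y₂`, `c = y₃`) — verbatim the `let formT` of
`relNearSymplecticTaubesTubes_exists` (Taubes 1998, eq. (1.1),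
`ω = dt ∧ (x dx + y dy − 2z dz) + x dy∧dz − y dx∧dz − 2z dx∧dy`). [cite: Taubes1998S1B3, eq. (1.1)] -/
def untwistedTubeForm (y u v : E4) : ℝ :=
  toroidalDt y u * untwistedDQ y v - toroidalDt y v * untwistedDQ y u
    + (toroidalR y - 1) * (u 2 * v 3 - v 2 * u 3)
    + y 2 * (u 3 * toroidalDa y v - v 3 * toroidalDa y u)
    - 2 * y 3 * (toroidalDa y u * v 2 - toroidalDa y v * u 2)

/-- **The flat solid torus** `U_δ = {(√(y₀² + y₁²) − 1)² + y₂² + y₃² < δ²}` about the unit circle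
(verbatim the `let U` of the named fact; Taubes 1998, §1: `S¹ × B³`). [cite: Taubes1998S1B3, §1.c] -/
def flatSolidTorus (δ : ℝ) : Set E4 :=
  {y | (Real.sqrt (y 0 ^ 2 + y 1 ^ 2) - 1) ^ 2 + y 2 ^ 2 + y 3 ^ 2 < δ ^ 2}

/-- **The core circle** `C₀ = {y₀² + y₁² = 1, y₂ = y₃ = 0}` (verbatim the `let C` of the named
fact). [cite: Taubes1998S1B3, §1.c] -/
def flatCoreCircle : Set E4 :=
  {y | y 0 ^ 2 + y 1 ^ 2 = 1 ∧ y 2 = 0 ∧ y 3 = 0}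

/-- Membership in the flat solid torus, unfolded. [folklore] -/
theorem mem_flatSolidTorus {δ : ℝ} {y : E4} :
    y ∈ flatSolidTorus δ ↔ (toroidalR y - 1) ^ 2 + y 2 ^ 2 + y 3 ^ 2 < δ ^ 2 := Iff.rfl

/-- Membership in the core circle, unfolded. [folklore] -/
theorem mem_flatCoreCircle {y : E4} :
    y ∈ flatCoreCircle ↔ y 0 ^ 2 + y 1 ^ 2 = 1 ∧ y 2 = 0 ∧ y 3 = 0 := Iff.rfl

/-- `toroidalR y ^ 2 = y₀² + y₁²`. [folklore] -/
theorem toroidalR_sq (y : E4) : toroidalR y ^ 2 = y 0 ^ 2 + y 1 ^ 2 :=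
  Real.sq_sqrt (by positivity)

/-- `0 ≤ toroidalR y`. [folklore] -/
theorem toroidalR_nonneg (y : E4) : 0 ≤ toroidalR y := Real.sqrt_nonneg _

/-- In a flat solid torus of radius `δ ≤ 1` the distance from the axis is positive (the tube
misses the axis, so the junk values of `dt`, `da` are never met). [folklore] -/
theorem toroidalR_pos_of_mem_flatSolidTorus {δ : ℝ} (hδ₀ : 0 ≤ δ) (hδ : δ ≤ 1) {y : E4}
    (hy : y ∈ flatSolidTorus δ) : 0 < toroidalR y := by
  rw [mem_flatSolidTorus] at hy
  have hδ2 : δ ^ 2 ≤ 1 := by nlinarith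
  have h1 : (toroidalR y - 1) ^ 2 < 1 := by nlinarith [sq_nonneg (y 2), sq_nonneg (y 3)]
  nlinarith [toroidalR_nonneg y]

/-- The core circle lies in every flat solid torus of positive radius. [folklore] -/
theorem flatCoreCircle_subset_flatSolidTorus {δ : ℝ} (hδ : 0 < δ) :
    flatCoreCircle ⊆ flatSolidTorus δ := by
  intro y hy
  rcases hy with ⟨h01, h2, h3⟩
  have : toroidalR y = 1 := by simp [toroidalR, h01]
  simpa [mem_flatSolidTorus, this, h2, h3] using pow_pos hδ 2

/-- Shrinking the radius shrinks the flat solid torus. [folklore] -/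
theorem flatSolidTorus_mono {δ δ' : ℝ} (hδ : 0 ≤ δ) (h : δ ≤ δ') :
    flatSolidTorus δ ⊆ flatSolidTorus δ' := fun _ hy =>
  lt_of_lt_of_le (mem_flatSolidTorus.1 hy) (pow_le_pow_left₀ hδ h 2)

/-- **The substitution identity `T*ω_A = formT` (algebraic half).**  If `q` has normal
coordinates `(a, b, c) = (r − 1, y₂, y₃)` and `U, V` have components
`(dt u, da u, u₂, u₃)`, `(dt v, da v, v₂, v₃)` — the values and derivatives of the toroidal
coordinate map at `y` on `u, v` — then `ω_A(q)(U, V) = formT(y)(u, v)`; the angular coordinate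
`q 0` is irrelevant (`S¹`-invariance). [cite: Taubes1998S1B3, eq. (1.1)] -/
theorem hondaFormA_eq_untwistedTubeForm {y q U V u v : E4}
    (hq1 : q 1 = toroidalR y - 1) (hq2 : q 2 = y 2) (hq3 : q 3 = y 3)
    (hU0 : U 0 = toroidalDt y u) (hU1 : U 1 = toroidalDa y u) (hU2 : U 2 = u 2) (hU3 : U 3 = u 3)
    (hV0 : V 0 = toroidalDt y v) (hV1 : V 1 = toroidalDa y v) (hV2 : V 2 = v 2) (hV3 : V 3 = v 3) :
    hondaFormA q U V = untwistedTubeForm y u v := by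
  simp only [hondaFormA, hondaDQ, untwistedTubeForm, untwistedDQ, hq1, hq2, hq3, hU0, hU1, hU2,
    hU3, hV0, hV1, hV2, hV3]

/-- **`formT` is non-degenerate off the core inside a tube of radius `≤ 1`** whenever the
toroidal coframe `(dt, da, dy₂, dy₃)` at `y` is realised by an injective linear map `L`
(as it is by the derivative of the toroidal coordinate map): transported from
`hondaFormA_nondegenerate`. [cite: Taubes1998S1B3, eq. (1.1)] -/
theorem untwistedTubeForm_nondegenerate_of_frame {y : E4} (L : E4 →ₗ[ℝ] E4)
    (hL0 : ∀ u, L u 0 = toroidalDt y u) (hL1 : ∀ u, L u 1 = toroidalDa y u)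
    (hL2 : ∀ u, L u 2 = u 2) (hL3 : ∀ u, L u 3 = u 3) (hL : Function.Surjective L)
    (hy : ¬ (toroidalR y = 1 ∧ y 2 = 0 ∧ y 3 = 0)) {u : E4} (hu : L u ≠ 0) :
    ∃ v : E4, untwistedTubeForm y u v ≠ 0 := by
  set q : E4 := WithLp.toLp 2 ![0, toroidalR y - 1, y 2, y 3] with hq
  have hqax : q ∉ hondaAxis := by
    rintro ⟨h1, h2, h3⟩
    apply hy
    simp only [hq, PiLp.toLp_apply, Matrix.cons_val_one, Matrix.cons_val_zero,
      Matrix.cons_val] at h1 h2 h3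
    exact ⟨by linarith, h2, h3⟩
  obtain ⟨V, hV⟩ := hondaFormA_nondegenerate hqax hu
  obtain ⟨v, rfl⟩ := hL V
  refine ⟨v, ?_⟩
  rwa [hondaFormA_eq_untwistedTubeForm (y := y) (u := u) (v := v) (by simp [hq]) (by simp [hq])
    (by simp [hq]) (hL0 u) (hL1 u) (hL2 u) (hL3 u) (hL0 v) (hL1 v) (hL2 v) (hL3 v)] at hV

/-! ### The complex coordinate `z = y₀ + iy₁` -/

/-- `z(y) = y₀ + iy₁`, the complex coordinate of the first factor of `ℝ⁴ = ℂ × ℝ²`. [folklore] -/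
def toroidalZ (y : E4) : ℂ := ⟨y 0, y 1⟩

/-- `z` as a continuous linear map. [folklore] -/
def toroidalZCLM : E4 →L[ℝ] ℂ :=
  Complex.equivRealProdCLM.symm.toContinuousLinearMap.comp
    ((EuclideanSpace.proj 0).prod (EuclideanSpace.proj 1))

/-- The continuous linear map `toroidalZCLM` is `z`. [folklore] -/
@[simp] theorem toroidalZCLM_apply (y : E4) : toroidalZCLM y = toroidalZ y := rfl

/-- `z` is its own derivative. [folklore] -/
theorem hasFDerivAt_toroidalZ (y : E4) : HasFDerivAt toroidalZ toroidalZCLM y :=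
  toroidalZCLM.hasFDerivAt

/-- `z` is smooth. [folklore] -/
theorem contDiff_toroidalZ {n : WithTop ℕ∞} : ContDiff ℝ n toroidalZ :=
  toroidalZCLM.contDiff

/-- `|z|² = y₀² + y₁²`. [folklore] -/
theorem normSq_toroidalZ (y : E4) : Complex.normSq (toroidalZ y) = y 0 ^ 2 + y 1 ^ 2 := by
  simp [toroidalZ, Complex.normSq_apply, sq]

/-- `|z| = r = toroidalR y`. [folklore] -/
theorem norm_toroidalZ (y : E4) : ‖toroidalZ y‖ = toroidalR y := by
  rw [Complex.norm_def, normSq_toroidalZ]; rfl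

/-- Off the axis, `z ≠ 0`. [folklore] -/
theorem toroidalZ_ne_zero {y : E4} (hy : 0 < toroidalR y) : toroidalZ y ≠ 0 := by
  rw [← norm_pos_iff, norm_toroidalZ]; exact hy

end Literature.Geometry.Symplectic

end
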